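import Literature.AlgebraicGeometry.Resolution.AlterationsFormalNodesPresentation
import Literature.AlgebraicGeometry.Resolution.AlterationsNodalBoundary
import Literature.AlgebraicGeometry.Resolution.AlterationsCodimThreeExponents
import Literature.AlgebraicGeometry.Resolution.WeakJacobianPolynomial
import HarnessLib

/-!
# De Jong 1996, 3.5 [B3]: `DeJong1996CodimThreeNodalForm` from the split nodal structure and Mizutani's theorem

Topic: `Literature/AlgebraicGeometry/Resolution`. The trust base of the named fact
`DeJong1996CodimThreeNodalForm` (`AlterationsIsNormalFormParts.lean`; de Jong 1996, 3.5 with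
4.25 (ii): the nodal normal form `k⟦u, v, t₁, …, t_{d-1}⟧/(uv - t₁ ⋯ t_s)`, `2 ≤ s ≤ r ≤ d - 1`,
boundary `t₁ ⋯ t_r`, at the singular closed points of a pair in Situation 4.23 with
`codim(Sing(X), X) ≥ 3`) after its decomposition along the printed proof:

* `AlterationsCodimThreeNodalFormParts.lean` — [B3] from the presentation of 3.3
  (`DeJong1996SemiStableNodalPresentation`), the boundary clause
  (`DeJong1996SemiStableNodalBoundary`) and "`nᵢ ∈ {0, 1}`" (`DeJong1996CodimThreeExponentsLeOne`),
  the renumbering proved;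
* `AlterationsFormalNodesPresentation.lean` — the presentation from the split nodal structure
  2.23/3.3 (`DeJong1996SplitNodalStructure`, `AlterationsFormalNodes.lean`), "`Σ nᵢ ≥ 2`" proved;
* `AlterationsNodalBoundary.lean` — the boundary clause PROVED (`DeJong1996SemiStableNodalBoundary_holds`);
* `AlterationsCodimThreeExponents.lean` — "`nᵢ ∈ {0, 1}`" PROVED from the G-ring property of
  polynomial rings over a field (`Matsumura1987_32_polynomial`), itself reduced in
  `WeakJacobianPolynomial.lean` to H. Mizutani's theorem (`Matsumura1987_32_6`, Matsumura Thm. 32.6).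

Hence [B3] rests on exactly two standard leaves: the formal structure of an ordinary double point
of a semi-stable curve over a complete regular local base (de Jong 2.23 with 3.3,
`DeJong1996SplitNodalStructure`) and Mizutani's theorem (a regular ring with (WJ) in all its
polynomial rings is a G-ring, `Matsumura1987_32_6`).

* `DeJong1996CodimThreeNodalForm.of_splitNodalStructure_of_polynomial`,
  `DeJong1996CodimThreeNodalForm.of_splitNodalStructure_of_mizutani`.

## Sources

* A. J. de Jong, *Smoothness, semi-stability and alterations*, Publ. Math. IHÉS 83 (1996) 51–93:
  2.23 (pp. 61–62), 3.3–3.5 (pp. 63–64), 4.24–4.25 (p. 75).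
* H. Matsumura, *Commutative Ring Theory* (1986), Thm. 32.6 and its Corollary (p. 260).
-/

noncomputable section

namespace Literature.AlgebraicGeometry.Resolution

universe u

/-- **[B3] from the split nodal structure (2.23/3.3) and the G-ring property of polynomial rings
over a field**: `DeJong1996SplitNodalStructure → Matsumura1987_32_polynomial →
DeJong1996CodimThreeNodalForm`, the boundary clause being proved
(`DeJong1996SemiStableNodalBoundary_holds`) and "`nᵢ ∈ {0, 1}`" reduced to the G-ring leaf
(`DeJong1996CodimThreeExponentsLeOne.of_polynomial`). [cite: DeJong1996, 3.5, p. 64] -/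
theorem DeJong1996CodimThreeNodalForm.of_splitNodalStructure_of_polynomial
    (hN : DeJong1996SplitNodalStructure.{u}) (hp : Matsumura1987_32_polynomial.{u}) :
    DeJong1996CodimThreeNodalForm.{u} :=
  DeJong1996CodimThreeNodalForm.of_splitNodal_of_boundary_of_exponents hN
    DeJong1996SemiStableNodalBoundary_holds (DeJong1996CodimThreeExponentsLeOne.of_polynomial hp)

/-- **[B3] from the split nodal structure and Mizutani's theorem** (Matsumura, Thm. 32.6:
`Matsumura1987_32_polynomial` follows from it, the weak Jacobian condition in polynomial rings
over a field being proved, `Matsumura1987_32_polynomial_of_32_6'`).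
[cite: DeJong1996, 3.5, p. 64] -/
theorem DeJong1996CodimThreeNodalForm.of_splitNodalStructure_of_mizutani
    (hN : DeJong1996SplitNodalStructure.{u}) (h326 : Matsumura1987_32_6.{u}) :
    DeJong1996CodimThreeNodalForm.{u} :=
  DeJong1996CodimThreeNodalForm.of_splitNodalStructure_of_polynomial hN
    (Matsumura1987_32_polynomial_of_32_6' h326)

end Literature.AlgebraicGeometry.Resolution

end
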